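import Mathlib
import Summits.KontsevichZagierPeriods.Zeta5Search.Profile12eCellsA
import Summits.KontsevichZagierPeriods.Zeta5Search.Profile12eCellsB
import Summits.KontsevichZagierPeriods.Zeta5Search.DenomLaw.Profile15aPath
import Summits.KontsevichZagierPeriods.Zeta5Search.DenomLaw.ZeroPointCoverKit
import Summits.KontsevichZagierPeriods.Zeta5Search.DenomLaw.ZeroCoverKit
import Summits.KontsevichZagierPeriods.Zeta5Search.DenomLaw.LawA3KCoverKit
import Summits.KontsevichZagierPeriods.Zeta5Search.DenomLaw.PathWeightProfile
import Summits.KontsevichZagierPeriods.Zeta5Search.FlagRayDominance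
import Summits.KontsevichZagierPeriods.Zeta5Search.TopFamilyFPCasLB
import HarnessLib

/-!
# ζ(5) search — the `N_p = 12` PROFILES 12e of the first period for EVERY sorted parameter vector: PATH accounting at every depth (DENOM-LAW D1, prover-d1 gen 22)

Cell `pub-zeta5` (HONEST FRAMING: systematic search; no irrationality claim unless certified), TRACK «DENOM-LAW» D1 prover seat (denom-prover-d1
gen 22, `HOME/denom-law/prover-d1/ATTEMPT-22.md` §6).  The five a = 7 profiles with exactly nine short pair blocks: 12a short `(i,k)` with `i ≤ 3, k ≤ 5`;
12b `i ≤ 2, k ≤ 6`; 12c `(1,2),…,(1,7),(2,3),(2,4),(3,4)`; 12d `(1,2),…,(1,7),(2,3),(2,4),(2,5)`; 12e `(1,2),…,(1,6),(2,3),(2,4),(2,5),(3,4)`.  On each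
`N_p = 12` and `p < d < 3p` (12e: `d < 2p`); `C⋆ ≤ 10` on 12a–12d (12a, 12b: new finite checks `cStar_le_ten_12a/12b`; 12c, 12d: gen 18's `cStar_le_ten_15a`),
`C⋆ ≤ 11` on 12e; so the node asks `−6 / −5` at `⌊d/p⌋ = 1 / 2` (12e: `−5`).  The machine-generated covers `FullProfile.cover12x_ev/od`
(`Profile12{a,…,e}Cells{A,B}`) pass the spelled-out checks of LANDED kits (`decide`): at `⌊d/p⌋ = 1` the LEMMA-D bonus with LB fallback (`TopFamFP.cover_J_j`,
`m = −5`; 12a pair `[1,−6,−1,1]`, 12c pair `[1,−5,−2,1]`), THEOREM A‴ in 𝒦-form (`DenomLaw.cover_A3K` at `(6, [1,−4,−4,1])`; 12b, 12d) or THEOREM LB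
(`casLB_ge_of_cover` at `(−4, −1)`; 12e); at `⌊d/p⌋ = 2` the ZERO-POINT law at `M = 6` (`DenomLaw.zeroPointBound_of_classes`; 12a `(6; [], [[1,−6,−1,1]])`,
12b / 12d `(6; [[1,−4,−4,1]], [])`, 12c `(6; [], [[1,−5,−2,1]])`).  Results: `pathAccounting_profile12x` (every `j`) and **`pathAccountingFirstPeriod_profile12x`**
(the node's binders VERBATIM plus `p ≤ b₇` and the profile inequalities; no depth hypothesis), x ∈ {e}.  Census beside the proof (gen 22, exhaustive a = 7
at p = 7, 11, 15 % sample at p = 13): 12a 4,239 · 12b 3,578 · 12c 2,747 · 12d 1,497 · 12e 515 instances, every one reached by exactly these rungs; 0 open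
at p ≤ 13 (kit j285126).
MODEL/structure-side valuation bookkeeping of the cell's own rationals; nothing about ζ(5); no γ; records in print UNMOVED.
-/

open Finset

namespace Summit.KontsevichZagierPeriods.Zeta5Search.FullProfile

open Summit.KontsevichZagierPeriods.Zeta5Search.ClusterValuation
open Summit.KontsevichZagierPeriods.Zeta5Search.CasoratianValuation (InPolytope shift casoratian pairFloors refund)
open Summit.KontsevichZagierPeriods.Zeta5Search.WedgeDictionary (dOf)
open Summit.KontsevichZagierPeriods.Zeta5Search.ClassTypeCover
open Summit.KontsevichZagierPeriods.Zeta5Search.DenomLaw (cStar FirstPeriod Sorted7 zeroClasses_of_cover zeroBound_of_classes zeroPointBound_of_classes cover_A3K)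
open Summit.KontsevichZagierPeriods.Zeta5Search.DenomLaw.FirstPeriodKit (cStar_le_eleven sorted7_chain firstPeriod_pair pairFloors_expand)
open Summit.KontsevichZagierPeriods.Zeta5Search.ZeroWindows (ZeroWindowClasses)
open Summit.KontsevichZagierPeriods.Zeta5Search.TopFamFP (cover_J_j)
open Summit.KontsevichZagierPeriods.Zeta5Search.StairFLAG (cover_B_j)
open Summit.KontsevichZagierPeriods.Zeta5Search.SortedProfile

/-! ## The `N_p = 12` profile with short blocks `(1,2),…,(1,6),(2,3),(2,4),(2,5),(3,4)` -/

section P12E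

variable {b : ℕ → ℤ} {j p : ℕ}

/-- On this profile `p < d(b) < 3p` (from three long pair blocks, resp. the short blocks, the sorted chain and `p ≤ b₇ ≤ b₁ < 2p`). -/
theorem d_bounds12e (hs : Sorted7 b) (hP : (p : ℤ) ≤ b 7) (hQ : b 0 < (p : ℤ) + b 1 + b 6) (hQ25 : b 0 < (p : ℤ) + b 2 + b 5) (hQ34 : b 0 < (p : ℤ) + b 3 + b 4) (hQ7 : (p : ℤ) + b 1 + b 7 ≤ b 0) (hQ26 : (p : ℤ) + b 2 + b 6 ≤ b 0) (hQ35 : (p : ℤ) + b 3 + b 5 ≤ b 0) (hF1 : b 1 < 2 * (p : ℤ)) :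
    (p : ℤ) < dOf b ∧ dOf b < 3 * (p : ℤ) := by
  obtain ⟨h21, h32, h43, h54, h65, h76⟩ := sorted7_chain hs
  rw [DecompositionWholeCone.dOf_expand]; constructor <;> linarith

/-- **`N_p = 12`** on this profile: the pair digits of the nine short blocks are `0`, the other twelve are `1`. -/
theorem pairFloors_eq_12e (hb : InPolytope b) (hs : Sorted7 b) (hp : 0 < p) (hQ : b 0 < (p : ℤ) + b 1 + b 6) (hQ25 : b 0 < (p : ℤ) + b 2 + b 5) (hQ34 : b 0 < (p : ℤ) + b 3 + b 4) (hQ7 : (p : ℤ) + b 1 + b 7 ≤ b 0) (hQ26 : (p : ℤ) + b 2 + b 6 ≤ b 0) (hQ35 : (p : ℤ) + b 3 + b 5 ≤ b 0) (hfp : FirstPeriod b p) : pairFloors b p = 12 := by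
  obtain ⟨h21, h32, h43, h54, h65, h76⟩ := sorted7_chain hs
  obtain ⟨h0, hb1, hb2, hb3, hb4, hb5, hb6, hb7, hc1⟩ := box hb
  have hp0 : (0 : ℤ) < p := by exact_mod_cast hp
  have one : ∀ z : ℤ, (p : ℤ) ≤ z → z ≤ 2 * (p : ℤ) - 1 → z / (p : ℤ) = 1 := fun z h1 h2 => by
    rw [Int.ediv_eq_iff_of_pos hp0]; constructor <;> linarith
  have z12 : (b 0 - b 1 - b 2) / (p : ℤ) = 0 := Int.ediv_eq_zero_of_lt (by linarith) (by linarith)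
  have z13 : (b 0 - b 1 - b 3) / (p : ℤ) = 0 := Int.ediv_eq_zero_of_lt (by linarith) (by linarith)
  have z14 : (b 0 - b 1 - b 4) / (p : ℤ) = 0 := Int.ediv_eq_zero_of_lt (by linarith) (by linarith)
  have z15 : (b 0 - b 1 - b 5) / (p : ℤ) = 0 := Int.ediv_eq_zero_of_lt (by linarith) (by linarith)
  have z16 : (b 0 - b 1 - b 6) / (p : ℤ) = 0 := Int.ediv_eq_zero_of_lt (by linarith) (by linarith)
  have z23 : (b 0 - b 2 - b 3) / (p : ℤ) = 0 := Int.ediv_eq_zero_of_lt (by linarith) (by linarith)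
  have z24 : (b 0 - b 2 - b 4) / (p : ℤ) = 0 := Int.ediv_eq_zero_of_lt (by linarith) (by linarith)
  have z25 : (b 0 - b 2 - b 5) / (p : ℤ) = 0 := Int.ediv_eq_zero_of_lt (by linarith) (by linarith)
  have z34 : (b 0 - b 3 - b 4) / (p : ℤ) = 0 := Int.ediv_eq_zero_of_lt (by linarith) (by linarith)
  have U := fun (i k : ℕ) (hi : i < 7) (hk : k < 7) (hik : i < k) => firstPeriod_pair hfp hi hk hik
  rw [pairFloors_expand, z12, z13, z14, z15, z16, z23, z24, z25, z34,
    one _ (by linarith) (U 0 6 (by norm_num) (by norm_num) (by norm_num)),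
    one _ (by linarith) (U 1 5 (by norm_num) (by norm_num) (by norm_num)),
    one _ (by linarith) (U 1 6 (by norm_num) (by norm_num) (by norm_num)),
    one _ (by linarith) (U 2 4 (by norm_num) (by norm_num) (by norm_num)),
    one _ (by linarith) (U 2 5 (by norm_num) (by norm_num) (by norm_num)),
    one _ (by linarith) (U 2 6 (by norm_num) (by norm_num) (by norm_num)),
    one _ (by linarith) (U 3 4 (by norm_num) (by norm_num) (by norm_num)),
    one _ (by linarith) (U 3 5 (by norm_num) (by norm_num) (by norm_num)),
    one _ (by linarith) (U 3 6 (by norm_num) (by norm_num) (by norm_num)),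
    one _ (by linarith) (U 4 5 (by norm_num) (by norm_num) (by norm_num)),
    one _ (by linarith) (U 4 6 (by norm_num) (by norm_num) (by norm_num)),
    one _ (by linarith) (U 5 6 (by norm_num) (by norm_num) (by norm_num))]
  norm_num

/-- **THEOREM LB on this profile, general `b`**: `v_p(Cas_j(b)) ≥ VB + row = casLB` from a spelled-out `checkLB` on both covers. -/
theorem cas_ge12e_neg5 (hb : InPolytope b) (hs : Sorted7 b) (hbj : InPolytope (shift b j)) (hj1 : 1 ≤ j) (hj7 : j ≤ 7)
    (hprime : p.Prime) (hp5 : 5 ≤ p) (hwin : (b 0 + 2 : ℤ) < (p : ℤ) ^ 2) (hP : (p : ℤ) ≤ b 7) (hQ : b 0 < (p : ℤ) + b 1 + b 6) (hQ25 : b 0 < (p : ℤ) + b 2 + b 5) (hQ34 : b 0 < (p : ℤ) + b 3 + b 4) (hQ7 : (p : ℤ) + b 1 + b 7 ≤ b 0) (hQ26 : (p : ℤ) + b 2 + b 6 ≤ b 0) (hQ35 : (p : ℤ) + b 3 + b 5 ≤ b 0)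
    (hF1 : b 1 < 2 * (p : ℤ)) (hF2 : b 0 < 2 * (p : ℤ) + b 6 + b 7) (hcas : casoratian b j ≠ 0) : (-5 : ℤ) ≤ padicValRat p (casoratian b j) := by
  haveI : Fact p.Prime := ⟨hprime⟩
  have hp2 : p % 2 = 1 := Nat.odd_iff.1 (hprime.odd_of_ne_two (by omega))
  obtain ⟨h21, h32, h43, h54, h65, h76⟩ := sorted7_chain hs
  obtain ⟨h0, hb1, hb2, hb3, hb4, hb5, hb6, hb7, hc1⟩ := box hb
  have hpd : (p : ℤ) ≤ dOf b := by rw [DecompositionWholeCone.dOf_expand]; linarith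
  have hv := casoratianClassBound_holds b j p hb hj1 hj7 hbj hprime hp5 hwin hcas
  rcases Int.emod_two_eq_zero_or_one (b 0) with hr | hr
  · rcases casLB_ge_of_cover (cover12e_ev hb hs hP hQ hQ25 hQ34 hQ7 hQ26 hQ35 hF1 hF2 hp5 hp2 hr) (A := -4) (B := -1)
        (by rw [oddFlag_false hr]; decide) (by norm_num) hpd with h0 | h
    · rw [h0] at hv; linarith
    · linarith
  · rcases casLB_ge_of_cover (cover12e_od hb hs hP hQ hQ25 hQ34 hQ7 hQ26 hQ35 hF1 hF2 hp5 hp2 hr) (A := -4) (B := -1)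
        (by rw [oddFlag_true hr]; decide) (by norm_num) hpd with h0 | h
    · rw [h0] at hv; linarith
    · linarith

/-- On this profile `p < d(b) < 2p` (three long blocks; the three short blocks `(1,6)`, `(2,5)`, `(3,4)` and `p ≤ b₇`). -/
theorem d_lt_two12e (hs : Sorted7 b) (hP : (p : ℤ) ≤ b 7) (_hQ : b 0 < (p : ℤ) + b 1 + b 6) (_hQ25 : b 0 < (p : ℤ) + b 2 + b 5) (_hQ34 : b 0 < (p : ℤ) + b 3 + b 4) (_hQ7 : (p : ℤ) + b 1 + b 7 ≤ b 0) (_hQ26 : (p : ℤ) + b 2 + b 6 ≤ b 0) (_hQ35 : (p : ℤ) + b 3 + b 5 ≤ b 0) : dOf b < 2 * (p : ℤ) := by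
  obtain ⟨h21, h32, h43, h54, h65, h76⟩ := sorted7_chain hs
  rw [DecompositionWholeCone.dOf_expand]; linarith

/-- **`PathAccountingFirstPeriod`'s conclusion on this `N_p = 12` profile (short blocks `(1,2),…,(1,6),(2,3),(2,4),(2,5),(3,4)`), EVERY sorted `b`, every direction `j`** (`C⋆ ≤ 11`, `p < d < 2p`:
the node asks `1 − 12 + 6 = -5`). -/
theorem pathAccounting_profile12e (b : ℕ → ℤ) (j p : ℕ) (hb : InPolytope b) (hs : Sorted7 b) (hbj : InPolytope (shift b j))
    (hj1 : 1 ≤ j) (hj7 : j ≤ 7) (hprime : p.Prime) (hp5 : 5 ≤ p) (hwin : (b 0 + 2 : ℤ) < (p : ℤ) ^ 2) (hfp : FirstPeriod b p)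
    (hP : (p : ℤ) ≤ b 7) (hQ : b 0 < (p : ℤ) + b 1 + b 6) (hQ25 : b 0 < (p : ℤ) + b 2 + b 5) (hQ34 : b 0 < (p : ℤ) + b 3 + b 4) (hQ7 : (p : ℤ) + b 1 + b 7 ≤ b 0) (hQ26 : (p : ℤ) + b 2 + b 6 ≤ b 0) (hQ35 : (p : ℤ) + b 3 + b 5 ≤ b 0)
    (hcas : casoratian b j ≠ 0) :
    dOf b / (p : ℤ) - pairFloors b p - min (if 2 ≤ dOf b / (p : ℤ) then (1 : ℤ) else 0) (5 - (cStar b p : ℤ))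
      ≤ padicValRat p (casoratian b j) := by
  obtain ⟨hF1, hF2⟩ := fp_bounds hfp
  have hp0 : (0 : ℤ) < p := by exact_mod_cast hprime.pos
  rw [pairFloors_eq_12e hb hs hprime.pos hQ hQ25 hQ34 hQ7 hQ26 hQ35 hfp]
  have hC11 : (cStar b p : ℤ) ≤ 11 := by exact_mod_cast cStar_le_eleven b p
  have hmin : -6 ≤ min (if 2 ≤ dOf b / (p : ℤ) then (1 : ℤ) else 0) (5 - (cStar b p : ℤ)) :=
    le_min (by split_ifs <;> norm_num) (by linarith)
  have hfd : dOf b / (p : ℤ) < 2 := by rw [Int.ediv_lt_iff_lt_mul hp0]; linarith [d_lt_two12e hs hP hQ hQ25 hQ34 hQ7 hQ26 hQ35]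
  linarith [cas_ge12e_neg5 hb hs hbj hj1 hj7 hprime hp5 hwin hP hQ hQ25 hQ34 hQ7 hQ26 hQ35 hF1 hF2 hcas]

/-- **THE NODE ON THIS `N_p = 12` PROFILE, EVERY SORTED `b`: `PathAccountingFirstPeriod` with its binders VERBATIM plus `p ≤ b₇` and the profile
inequalities.** -/
theorem pathAccountingFirstPeriod_profile12e :
    ∀ (b : ℕ → ℤ) (p : ℕ), InPolytope b → Sorted7 b → InPolytope (shift b 7) →
      p.Prime → 5 ≤ p → (b 0 + 2 : ℤ) < (p : ℤ) ^ 2 → FirstPeriod b p →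
      (p : ℤ) ≤ b 7 → b 0 < (p : ℤ) + b 1 + b 6 → b 0 < (p : ℤ) + b 2 + b 5 → b 0 < (p : ℤ) + b 3 + b 4 → (p : ℤ) + b 1 + b 7 ≤ b 0 → (p : ℤ) + b 2 + b 6 ≤ b 0 → (p : ℤ) + b 3 + b 5 ≤ b 0 → casoratian b 7 ≠ 0 →
        dOf b / (p : ℤ) - pairFloors b p - min (if 2 ≤ dOf b / (p : ℤ) then (1 : ℤ) else 0) (5 - (cStar b p : ℤ))
          ≤ padicValRat p (casoratian b 7) :=
  fun b p hb hs hb7 hprime hp5 hwin hfp hP hQ hQ25 hQ34 hQ7 hQ26 hQ35 hcas =>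
    pathAccounting_profile12e b 7 p hb hs hb7 (by norm_num) (by norm_num) hprime hp5 hwin hfp hP hQ hQ25 hQ34 hQ7 hQ26 hQ35 hcas

end P12E

end Summit.KontsevichZagierPeriods.Zeta5Search.FullProfile
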